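import Summits.ResolutionOfSingularities.ResolutionOfSingularities.Theorems.EquisingularLiftEquisingularLiftNatVertexLineUnobs
import Summits.ResolutionOfSingularities.ResolutionOfSingularities.Theorems.EquisingularLiftEquisingularLiftNatThreeLinesCharts
import HarnessLib

/-!
# [OURS · L1 W4.5(b) · EL♮(3) · nose residue, (c) file 5a] SECTIONS FOR THE THREE-LINE CERTIFICATE: the plane polynomials as sections
# over the linear-system chart, read on the vertex chart `Spec C₀` and on the lifted chart `D₊(x₀)` through the model `k[u₁,u₂][T]`

Crux chain w45b, child EL♮(3) = stmt-ResolutionOfSingularities-20148; WIDTH seat res-L1-w45b-nose-w3 g3 (D-0157 DOOR 1), brick (c) = the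
×3 UNION certificate `DirStepUnobs F₂ univ (⋃ i, vertexLineStrict υ i)` (027's (U1) recipe of record). `--supports stmt-ResolutionOfSingularities-20148
--as helper`. OURS; NOT a statement of any manuscript; AI-written, weaker than expert review. No `sorry`; standard axioms; DEF-FREE (the kit's
local-instance attributes are needed to write `Proj k[x]` and the `k`-algebra `(k[x]_{(x₀)})₀`). Resolution in char `p` NOT proved here.

WHAT (`b : P̃ ⟶ ℙ³_k` ANY blowing up of the vertex, `c₀ = vertexChart hb 0`, `cB` the lifted chart of `D₊(x₀)`; the plane polynomial ring
`R₂ = k[u₁,u₂]` is mapped into `Γ(P̃, lsChart z 0)` by `σ : uⱼ ↦ z_{j+1}/z₀` (`lsRatio`), constants along `P̃ → Spec k`):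
* `apply_mem_basicOpen_iff` — for a chart `c : Spec R ⟶ P`: `c 𝔭 ∈ D(θ⁻¹ r) ↔ r ∉ 𝔭`.
* `chartRingEquiv_constant_B` — constants read on the lifted chart are the constants of `(k[x]_{(x₀)})₀` (twin of ✓ `chartRingEquiv_constant`).
* ★ `chartRingEquiv_sigma_A` / ★ `chartRingEquiv_sigma_B` — **`θ_A((σ r)|_A) = Φ_A(C r)` and `θ_B((σ r)|_B) = Φ_B(C r)`** for every `r ∈ R₂`, for any model
  identifications `Φ_A`, `Φ_B` with the values of ✓ `exists_modelEquiv_chart` / ✓ `exists_modelEquiv_away` (`MvPolynomial.ringHom_ext`).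
* `preimage_iUnion_lines_eq_zeroLocus` — from the three per-line chart identities: `c⁻¹(⋃ᵢ Lᵢ′) = V(Φ(𝔮₀₀ ∩ 𝔮₁₀ ∩ 𝔮₀₁))`; `isRadical_map_inf₃`.
* `C_ell_sub_mem`, `map_ell_notMem` — `ℓ ≡ ℓ(q) mod 𝔮_q`, so `Φ ℓ ∉ 𝔭` at every point `𝔭 ⊇ Φ(𝔮_q)` (`ℓ(q) ≠ 0`, ✓ CI3 `eval_ell_ne_zero`).

References (index only): R. Hartshorne (1977), II §7, II Thm. 7.1 [cite: Hartshorne1977]; The Stacks Project, Tag 0804 [cite: StacksProject];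
A. J. de Jong (1996), proof of Lemma 4.11 [cite: DeJong1996].
-/

set_option linter.dupNamespace false -- mandated namespace `Summit.<Summit>.<Problem>` of this single-conjunct summit

noncomputable section

-- `Proj`/`ProjectiveSpectrum` carrier coercions under `instances` transparency (as in the chain's other chart files).
set_option backward.isDefEq.respectTransparency false

open CategoryTheory AlgebraicGeometry TopologicalSpace HomogeneousLocalization Topology Opposite MvPolynomial
open Literature.AlgebraicGeometry.Resolution Literature.AlgebraicGeometry.Resolution.DeJong1996
open Literature.AlgebraicGeometry.Resolution.PointBlowup (Chart Base frac exc)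
open Literature.AlgebraicGeometry.Motives.Segre (grading X_mem chartι toSpec cst)
open Literature.AlgebraicGeometry.Motives.RatFn
open AlgebraicGeometry.Scheme.IdealSheafData

attribute [local instance] MvPolynomial.gradedAlgebra Literature.AlgebraicGeometry.Motives.ProjBaseChange.algebraBase
  Literature.AlgebraicGeometry.Motives.ProjBaseChange.isScalarTower_localization

namespace Summit.ResolutionOfSingularities.ResolutionOfSingularities.Cruxes.EquisingularLiftNat.Sections

namespace ThreeLines

/-! ## A chart point lies in `D(θ⁻¹ r)` iff `r ∉ 𝔭` -/

/-- For a chart `c : Spec R ⟶ P`: **`c 𝔭 ∈ D(θ⁻¹ r) ↔ r ∉ 𝔭`** (`θ⁻¹ r = (c.appIso ⊤)⁻¹ (ΓSpecIso⁻¹ r)`). [folklore] -/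
theorem apply_mem_basicOpen_iff {P : Scheme.{0}} {R : CommRingCat.{0}} (c : Spec R ⟶ P) [IsOpenImmersion c] (r : R) (𝔭 : Spec R) :
    c 𝔭 ∈ P.basicOpen ((c.appIso ⊤).inv ((Scheme.ΓSpecIso R).inv r)) ↔ r ∉ 𝔭.asIdeal := by
  rw [← Scheme.image_basicOpen c, basicOpen_eq_of_affine', Iso.inv_hom_id_apply]
  change c 𝔭 ∈ c '' _ ↔ _
  rw [c.isOpenEmbedding.injective.mem_set_image]
  exact PrimeSpectrum.mem_basicOpen r 𝔭

/-! ## Constants on the lifted chart -/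

section Constants

variable {d : ℕ} {k : Type} [Field k] {P : Scheme.{0}} (b : P ⟶ Proj (grading (Fin (d + 1 + 1)) k)) (i₀ : Fin (d + 1))
  (cB : Spec (.of (Away (grading (Fin (d + 1 + 1)) k) (MvPolynomial.X (Fin.castSucc i₀)))) ⟶ P) [IsOpenImmersion cB]
  (hcB : cB ≫ b = chartι k (Fin.castSucc i₀))

include hcB in
/-- **The constants read on the lifted chart `D₊(x_{i₀'})` are the constants of `(k[x]_{(x_{i₀'})})₀`** (the chart lies over `Spec k` through
`chartι ≫ toSpec = Spec (cst)`; twin of ✓ `chartRingEquiv_constant`). [folklore] -/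
theorem chartRingEquiv_constant_B (a : k) :
    (Scheme.ΓSpecIso (.of (Away (grading (Fin (d + 1 + 1)) k) (MvPolynomial.X (Fin.castSucc i₀))))).hom ((cB.appIso ⊤).hom
      ((P.presheaf.map (homOfLE (le_top : cB ''ᵁ ⊤ ≤ ⊤)).op).hom
        (((b ≫ toSpec (Fin (d + 1 + 1)) k).appTop).hom ((Scheme.ΓSpecIso (.of k)).inv a)))) =
      algebraMap k (Away (grading (Fin (d + 1 + 1)) k) (MvPolynomial.X (Fin.castSucc i₀))) a := by
  have h1 : (cB.appIso ⊤).hom ((P.presheaf.map (homOfLE (le_top : cB ''ᵁ ⊤ ≤ ⊤)).op).hom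
        (((b ≫ toSpec (Fin (d + 1 + 1)) k).appTop).hom ((Scheme.ΓSpecIso (.of k)).inv a))) =
      cB.appTop (((b ≫ toSpec (Fin (d + 1 + 1)) k).appTop) ((Scheme.ΓSpecIso (.of k)).inv a)) := by
    rw [Scheme.Hom.appIso_hom', ← CommRingCat.comp_apply, Scheme.Hom.map_appLE,
      Literature.AlgebraicGeometry.Motives.GeneratingSections.appLE_top_top]
  have h2 : cB.appTop (((b ≫ toSpec (Fin (d + 1 + 1)) k).appTop) ((Scheme.ΓSpecIso (.of k)).inv a)) =
      (cB ≫ b ≫ toSpec (Fin (d + 1 + 1)) k).appTop ((Scheme.ΓSpecIso (.of k)).inv a) := by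
    rw [Scheme.Hom.comp_appTop]; rfl
  have hcomp : cB ≫ b ≫ toSpec (Fin (d + 1 + 1)) k = Spec.map (CommRingCat.ofHom (cst k (MvPolynomial.X (Fin.castSucc i₀)))) := by
    rw [← Category.assoc, hcB, Literature.AlgebraicGeometry.Motives.Segre.chartι_toSpec]
  have h3 := congrArg (fun φ => φ.hom ((Scheme.ΓSpecIso (.of k)).inv a))
    (Scheme.ΓSpecIso_naturality (CommRingCat.ofHom (cst k (MvPolynomial.X (Fin.castSucc i₀) : MvPolynomial (Fin (d + 1 + 1)) k))))
  simp only [CommRingCat.hom_comp, RingHom.comp_apply, CommRingCat.hom_ofHom] at h3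
  rw [h1, h2, hcomp, h3, Iso.inv_hom_id_apply, PointBlowup.cst_eq_algebraMap]

end Constants

/-! ## The plane polynomials as sections, read through the model on both charts -/

section Sigma

variable {k : Type} [Field k] {P : Scheme.{0}} (b : P ⟶ Proj (grading (Fin (2 + 1 + 1)) k)) [IsIntegral P] [IsDominant b]
  (hb : IsBlowup b (vertexIdealSheaf 2 k))

/-- ★ **On the vertex chart: `θ_A((σ r)|_A) = Φ_A(C r)` for all `r ∈ k[u₁,u₂]`**, where `σ : k[u₁,u₂] → Γ(P̃, lsChart z 0)` sends `uⱼ` to the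
ratio section `z_{j+1}/z₀` and constants to constants, and `Φ_A` is any model identification with the values of ✓ `exists_modelEquiv_chart`
(`θ_A(z_a/z₀|_A) = X_a/X_0` ✓ `chartRingEquiv_lsRatio`, constants ✓ `chartRingEquiv_constant`). [cite: DeJong1996, proof of Lemma 4.11] (OURS) -/
theorem chartRingEquiv_sigma_A (Φ : MvPolynomial Unit (MvPolynomial (Fin 2) k) ≃+* Chart 2 k 0)
    (hΦ0 : Φ (C (X 0)) = frac 2 k 0 1) (hΦ1 : Φ (C (X 1)) = frac 2 k 0 2) (hΦc : ∀ a : k, Φ (C (C a)) = algebraMap k (Chart 2 k 0) a)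
    (r : MvPolynomial (Fin 2) k) :
    (Scheme.ΓSpecIso (.of (Chart 2 k 0))).hom (((vertexChart hb 0).appIso ⊤).hom
      (P.presheaf.map (homOfLE (image_top_le_lsChart b hb 0)).op
        (MvPolynomial.eval₂Hom
          ((P.presheaf.map (homOfLE (le_top : lsChart (blowupRatFn b) 0 ≤ ⊤)).op).hom.comp
            (((b ≫ toSpec (Fin (2 + 1 + 1)) k).appTop).hom.comp (Scheme.ΓSpecIso (.of k)).inv.hom))
          (fun j : Fin 2 => lsRatio (blowupRatFn b) 0 (Fin.succ j)) r))) = Φ (C r) := by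
  -- both sides are ring homomorphisms `k[u₁,u₂] → C₀` of `r`
  set τ : Γ(P, lsChart (blowupRatFn b) 0) →+* Chart 2 k 0 :=
    (((vertexChart hb 0).appIso ⊤ ≪≫ Scheme.ΓSpecIso (.of (Chart 2 k 0))).commRingCatIsoToRingEquiv : Γ(P, vertexChart hb 0 ''ᵁ ⊤) →+* _).comp
      (P.presheaf.map (homOfLE (image_top_le_lsChart b hb 0)).op).hom with hτ
  set σ : MvPolynomial (Fin 2) k →+* Γ(P, lsChart (blowupRatFn b) 0) := MvPolynomial.eval₂Hom
    ((P.presheaf.map (homOfLE (le_top : lsChart (blowupRatFn b) 0 ≤ ⊤)).op).hom.comp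
      (((b ≫ toSpec (Fin (2 + 1 + 1)) k).appTop).hom.comp (Scheme.ΓSpecIso (.of k)).inv.hom))
    (fun j : Fin 2 => lsRatio (blowupRatFn b) 0 (Fin.succ j)) with hσ
  change τ (σ r) = (Φ.toRingHom.comp C) r
  rw [← RingHom.comp_apply]
  congr 1
  apply MvPolynomial.ringHom_ext
  · intro a
    change (Scheme.ΓSpecIso (.of (Chart 2 k 0))).hom (((vertexChart hb 0).appIso ⊤).hom
      (P.presheaf.map (homOfLE (image_top_le_lsChart b hb 0)).op (σ (C a)))) = Φ (C (C a))
    rw [hσ, MvPolynomial.eval₂Hom_C, RingHom.comp_apply, RingHom.comp_apply, hΦc]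
    change (Scheme.ΓSpecIso (.of (Chart 2 k 0))).hom (((vertexChart hb 0).appIso ⊤).hom
      (P.presheaf.map (homOfLE (image_top_le_lsChart b hb 0)).op (P.presheaf.map (homOfLE le_top).op _))) = _
    rw [constants_map b, chartRingEquiv_constant b hb 0 a]
  · intro j
    change (Scheme.ΓSpecIso (.of (Chart 2 k 0))).hom (((vertexChart hb 0).appIso ⊤).hom
      (P.presheaf.map (homOfLE (image_top_le_lsChart b hb 0)).op (σ (X j)))) = Φ (C (X j))
    rw [hσ, MvPolynomial.eval₂Hom_X', chartRingEquiv_lsRatio b hb 0]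
    fin_cases j
    · exact hΦ0.symm
    · exact hΦ1.symm

variable (cB : Spec (.of (Away (grading (Fin (2 + 1 + 1)) k) (MvPolynomial.X (Fin.castSucc (0 : Fin (2 + 1)))))) ⟶ P) [IsOpenImmersion cB]
  (hcB : cB ≫ b = chartι k (Fin.castSucc (0 : Fin (2 + 1))))

include hcB in
/-- ★ **On the lifted chart: `θ_B((σ r)|_B) = Φ_B(C r)` for all `r ∈ k[u₁,u₂]`** (`θ_B(z_a/z₀|_B) = x_a/x_0` ✓ `chartRingEquiv_lsRatio_B`, constants by
`chartRingEquiv_constant_B`), for any `Φ_B` with the values of ✓ `exists_modelEquiv_away`. [cite: DeJong1996, proof of Lemma 4.11] (OURS) -/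
theorem chartRingEquiv_sigma_B
    (Φ : MvPolynomial Unit (MvPolynomial (Fin 2) k) ≃+* Away (grading (Fin (2 + 1 + 1)) k) (X (Fin.castSucc (0 : Fin (2 + 1)))))
    (hΦ0 : Φ (C (X 0)) = Literature.AlgebraicGeometry.Motives.Segre.frac k (Fin.castSucc (0 : Fin (2 + 1))) (Fin.castSucc (1 : Fin (2 + 1))))
    (hΦ1 : Φ (C (X 1)) = Literature.AlgebraicGeometry.Motives.Segre.frac k (Fin.castSucc (0 : Fin (2 + 1))) (Fin.castSucc (2 : Fin (2 + 1))))
    (hΦc : ∀ a : k, Φ (C (C a)) = algebraMap k _ a) (r : MvPolynomial (Fin 2) k) :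
    (Scheme.ΓSpecIso (.of (Away (grading (Fin (2 + 1 + 1)) k) (X (Fin.castSucc (0 : Fin (2 + 1))))))).hom ((cB.appIso ⊤).hom
      (P.presheaf.map (homOfLE (image_top_le_lsChart_B 0 cB hcB)).op
        (MvPolynomial.eval₂Hom
          ((P.presheaf.map (homOfLE (le_top : lsChart (blowupRatFn b) 0 ≤ ⊤)).op).hom.comp
            (((b ≫ toSpec (Fin (2 + 1 + 1)) k).appTop).hom.comp (Scheme.ΓSpecIso (.of k)).inv.hom))
          (fun j : Fin 2 => lsRatio (blowupRatFn b) 0 (Fin.succ j)) r))) = Φ (C r) := by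
  set τ : Γ(P, lsChart (blowupRatFn b) 0) →+* Away (grading (Fin (2 + 1 + 1)) k) (X (Fin.castSucc (0 : Fin (2 + 1)))) :=
    ((cB.appIso ⊤ ≪≫ Scheme.ΓSpecIso (.of _)).commRingCatIsoToRingEquiv : Γ(P, cB ''ᵁ ⊤) →+* _).comp
      (P.presheaf.map (homOfLE (image_top_le_lsChart_B 0 cB hcB)).op).hom with hτ
  set σ : MvPolynomial (Fin 2) k →+* Γ(P, lsChart (blowupRatFn b) 0) := MvPolynomial.eval₂Hom
    ((P.presheaf.map (homOfLE (le_top : lsChart (blowupRatFn b) 0 ≤ ⊤)).op).hom.comp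
      (((b ≫ toSpec (Fin (2 + 1 + 1)) k).appTop).hom.comp (Scheme.ΓSpecIso (.of k)).inv.hom))
    (fun j : Fin 2 => lsRatio (blowupRatFn b) 0 (Fin.succ j)) with hσ
  change τ (σ r) = (Φ.toRingHom.comp C) r
  rw [← RingHom.comp_apply]
  congr 1
  apply MvPolynomial.ringHom_ext
  · intro a
    change (Scheme.ΓSpecIso (.of _)).hom ((cB.appIso ⊤).hom
      (P.presheaf.map (homOfLE (image_top_le_lsChart_B 0 cB hcB)).op (σ (C a)))) = Φ (C (C a))
    rw [hσ, MvPolynomial.eval₂Hom_C, RingHom.comp_apply, RingHom.comp_apply, hΦc]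
    change (Scheme.ΓSpecIso (.of _)).hom ((cB.appIso ⊤).hom
      (P.presheaf.map (homOfLE (image_top_le_lsChart_B 0 cB hcB)).op (P.presheaf.map (homOfLE le_top).op _))) = _
    rw [constants_map b, chartRingEquiv_constant_B b 0 cB hcB a]
  · intro j
    change (Scheme.ΓSpecIso (.of _)).hom ((cB.appIso ⊤).hom
      (P.presheaf.map (homOfLE (image_top_le_lsChart_B 0 cB hcB)).op (σ (X j)))) = Φ (C (X j))
    rw [hσ, MvPolynomial.eval₂Hom_X', chartRingEquiv_lsRatio_B 0 cB hcB]
    fin_cases j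
    · exact hΦ0.symm
    · exact hΦ1.symm

end Sigma

/-! ## The union of the three lines through a model identification; `ℓ` off the three lines -/

section Model

variable {k : Type} [Field k] {S : Type} [CommRing S] (Φ : MvPolynomial Unit (MvPolynomial (Fin 2) k) ≃+* S)

/-- `Φ` of the intersection of the three line ideals is radical. [folklore] -/
theorem isRadical_map_inf₃ :
    (((RingHom.ker (eval ![0, 0] : MvPolynomial (Fin 2) k →+* k)).map
          (C : MvPolynomial (Fin 2) k →+* MvPolynomial Unit (MvPolynomial (Fin 2) k)) ⊓
        (RingHom.ker (eval ![1, 0] : MvPolynomial (Fin 2) k →+* k)).map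
          (C : MvPolynomial (Fin 2) k →+* MvPolynomial Unit (MvPolynomial (Fin 2) k)) ⊓
        (RingHom.ker (eval ![0, 1] : MvPolynomial (Fin 2) k →+* k)).map
          (C : MvPolynomial (Fin 2) k →+* MvPolynomial Unit (MvPolynomial (Fin 2) k))).map Φ).IsRadical := by
  rw [← Ideal.comap_symm]
  exact isRadical_inf₃.comap _

/-- **From the three per-line chart identities to the union**: if `c⁻¹(Lᵢ′) = V(Φ 𝔮_{qᵢ})` for the three lines then
`c⁻¹(⋃ᵢ Lᵢ′) = V(Φ(𝔮₀₀ ∩ 𝔮₁₀ ∩ 𝔮₀₁))`. [folklore] -/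
theorem preimage_iUnion_eq_zeroLocus {X : Type} (c : X → PrimeSpectrum S) {Z : Fin (2 + 1) → Set (PrimeSpectrum S)}
    (hc : ∀ i, Z i = PrimeSpectrum.zeroLocus
      ((((RingHom.ker (eval ((![![0, 0], ![1, 0], ![0, 1]] : Fin (2 + 1) → Fin 2 → k) i) : MvPolynomial (Fin 2) k →+* k)).map
        (C : MvPolynomial (Fin 2) k →+* MvPolynomial Unit (MvPolynomial (Fin 2) k))).map Φ : Ideal S) : Set S)) :
    c ⁻¹' (⋃ i, Z i) = c ⁻¹' PrimeSpectrum.zeroLocus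
      ((((RingHom.ker (eval ![0, 0] : MvPolynomial (Fin 2) k →+* k)).map
          (C : MvPolynomial (Fin 2) k →+* MvPolynomial Unit (MvPolynomial (Fin 2) k)) ⊓
        (RingHom.ker (eval ![1, 0] : MvPolynomial (Fin 2) k →+* k)).map
          (C : MvPolynomial (Fin 2) k →+* MvPolynomial Unit (MvPolynomial (Fin 2) k)) ⊓
        (RingHom.ker (eval ![0, 1] : MvPolynomial (Fin 2) k →+* k)).map
          (C : MvPolynomial (Fin 2) k →+* MvPolynomial Unit (MvPolynomial (Fin 2) k))).map Φ : Ideal S) : Set S) := by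
  congr 1
  rw [← Ideal.comap_symm, Ideal.comap_inf, Ideal.comap_inf, PrimeSpectrum.zeroLocus_inf, PrimeSpectrum.zeroLocus_inf,
    Ideal.comap_symm, Ideal.comap_symm, Ideal.comap_symm]
  ext x
  simp only [Set.mem_iUnion, Set.mem_union]
  constructor
  · rintro ⟨i, hi⟩
    rw [hc i] at hi
    fin_cases i
    · exact Or.inl (Or.inl hi)
    · exact Or.inl (Or.inr hi)
    · exact Or.inr hi
  · rintro ((h | h) | h)
    · exact ⟨0, by rw [hc 0]; exact h⟩
    · exact ⟨1, by rw [hc 1]; exact h⟩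
    · exact ⟨2, by rw [hc 2]; exact h⟩

/-- `ℓ ≡ ℓ(q)` modulo the line ideal `𝔮_q`. [folklore] -/
theorem C_ell_sub_mem (c : k) (q : Fin 2 → k) :
    (C (X 1 + 1 + C c * (X 0 - 1)) - C (C (eval q (X 1 + 1 + C c * (X 0 - 1) : MvPolynomial (Fin 2) k))) :
        MvPolynomial Unit (MvPolynomial (Fin 2) k)) ∈
      (RingHom.ker (eval q : MvPolynomial (Fin 2) k →+* k)).map
        (C : MvPolynomial (Fin 2) k →+* MvPolynomial Unit (MvPolynomial (Fin 2) k)) := by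
  rw [← map_sub]
  refine Ideal.mem_map_of_mem _ ?_
  rw [RingHom.mem_ker, map_sub, eval_C, sub_self]

/-- ★ **`Φ ℓ ∉ 𝔭` at every point `𝔭` of the three lines read through `Φ`** (there `ℓ ≡ ℓ(q) ≠ 0`, a unit; ✓ CI3 `eval_ell_ne_zero`). [folklore] -/
theorem map_ell_notMem [Algebra k S] (hΦc : ∀ a : k, Φ (C (C a)) = algebraMap k S a) (c : k) (hc1 : c ≠ 1) (hc2 : c ≠ 2)
    (q : Fin 2 → k) (hq : q = ![0, 0] ∨ q = ![1, 0] ∨ q = ![0, 1]) (𝔭 : PrimeSpectrum S)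
    (h𝔭 : ((RingHom.ker (eval q : MvPolynomial (Fin 2) k →+* k)).map
        (C : MvPolynomial (Fin 2) k →+* MvPolynomial Unit (MvPolynomial (Fin 2) k))).map Φ ≤ 𝔭.asIdeal) :
    Φ (C (X 1 + 1 + C c * (X 0 - 1))) ∉ 𝔭.asIdeal := by
  intro h
  have hmem : Φ (C (X 1 + 1 + C c * (X 0 - 1)) - C (C (eval q (X 1 + 1 + C c * (X 0 - 1) : MvPolynomial (Fin 2) k)))) ∈ 𝔭.asIdeal :=
    h𝔭 (Ideal.mem_map_of_mem _ (C_ell_sub_mem c q))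
  rw [map_sub, hΦc] at hmem
  have hu : IsUnit (algebraMap k S (eval q (X 1 + 1 + C c * (X 0 - 1) : MvPolynomial (Fin 2) k))) :=
    (IsUnit.mk0 _ (ThreePointsCI.eval_ell_ne_zero c hc1 hc2 q hq)).map _
  have hin : algebraMap k S (eval q (X 1 + 1 + C c * (X 0 - 1) : MvPolynomial (Fin 2) k)) ∈ 𝔭.asIdeal := by
    have e : algebraMap k S (eval q (X 1 + 1 + C c * (X 0 - 1) : MvPolynomial (Fin 2) k)) =
        Φ (C (X 1 + 1 + C c * (X 0 - 1))) - (Φ (C (X 1 + 1 + C c * (X 0 - 1))) - algebraMap k S (eval q (X 1 + 1 + C c * (X 0 - 1)))) := by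
      ring
    rw [e]
    exact Ideal.sub_mem _ h hmem
  exact 𝔭.2.ne_top (Ideal.eq_top_of_isUnit_mem _ hin hu)

end Model

end ThreeLines

end Summit.ResolutionOfSingularities.ResolutionOfSingularities.Cruxes.EquisingularLiftNat.Sections

end
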